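import Literature.Topology.FourManifolds.CappedBallLid
import Literature.Topology.FourManifolds.FillLemma
import HarnessLib

/-!
# Data of the capped-ball step: cutoffs, the fill weight, the filled defining function, the
# sub-sphere function and its domain

Topic `Literature/Topology/FourManifolds`; fact seat of Alexander's theorem
(`provefact-Literature.Topology.FourManifolds.SphereEmbedding.schoenflies_exists_ball`, Schultens
(2014), Thm. 3.2.5).  **Everything in this file is proved.  It introduces explicit auxiliary
functions and sets (`def`s with closed-form bodies) and no named fact.**

In the inductive step of the printed proof (Schultens (2014), PDF p. 45) the sphere `S` is cut
along an innermost level circle and one of the two piecewise smooth spheres `D ∪ Dᵢ` is smoothed,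
recognised as bounding a ball, and absorbed.  The fact seat realises this with explicit functions
in normalised coordinates of `ℝ³` (height `x₂`, the circle the unit circle at height `0`, the
solid `A = {F ≤ 0}` with `F = ρ² - 1` near the vertical unit cylinder), continuing
`CappedBallLid.lean` (the lid function `G`).  This file fixes the remaining data, all as
closed-form definitions with parameters (`P` an admissible smooth positive part, `s` the scale,
`δ` the rounding width, `M` the push height, `E₁` the non-absorbed disc, `η` the box height):

* §1 cutoffs `latCutoff`, `vertCutoff`, `pushCutoff` (`ψ`: `0` on the box
  `BX = {ρ² ≤ (1+2s)², -5s ≤ x₂ ≤ 2s}`, `1` off `BX' = {ρ² < (1+3s)², -6s < x₂ < 3s}`, horizontal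
  gradient a nonnegative multiple of the horizontal position), `collarCutoff` (`χ_c`),
  `loCutoff`, `hiCutoff`, `latBlend`, `blendWeight` (`β`: `1` on the lid zone `LZ`, `0` off `LZ'`);
* §2 the **fill weight** `fillWeight = 1 + G + 2δ(1 - χ_c(x₂)) + M ψ`, the **filled defining
  function** `fillFun = F ⊓_δ (w - 1)` (the smooth minimum of `FillLemma.lean`: the solid with
  the rim collar of the lid added — the term `2δ(1 - χ_c)` keeps it equal to `F` below the rim,
  where `G = F`), the **sub-sphere function** `subFun = β G + (1 - β) F₂` and its **domain**
  `subDomain E₁ s η = (plugOne ∪ plugTwo)ᶜ` (the sub-sphere of the step is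
  `{x ∈ subDomain | subFun x = 0}`);
  also the closed box `closedBox`, the set `subSphere` itself, its pieces `lidPiece`,
  `lowPiece`, and the `Prop`-valued hypothesis bundles `Admissible P` (admissible positive
  parts, inhabited: `Admissible.exists`), `StepNF F E₁ E₂ w₀ η₀ ε₀` (normal-form data of the
  step: `F` smooth, `{F ≤ ε₀}` compact, regular zero set `E₁ ∪ E₂`, `F = ρ² - 1` on the box,
  `E₁`/`E₂` above/below height `0` in the box) and `StepScale s δ w₀ η₀` (the scales);
* §3–§7 the values of the cutoffs and of these functions in the various zones, their smoothness,
  the horizontal derivative of the fill weight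
  (`fderiv_fillWeight_apply_of_coord_two_eq_zero`: a positive multiple of the horizontal
  position), and that the domain is open.

## References

* J. Schultens, *Introduction to 3-Manifolds*, GSM 151 (2014), proof of Thm. 3.2.5 (PDF
  p. 45). [Schultens2014]
-/

open scoped RealInnerProductSpace Topology ContDiff
open Set Filter Metric Function

noncomputable section

namespace Literature.Topology.FourManifolds

namespace CappedBallLid

variable {P : ℝ → ℝ} {s δ M : ℝ}

/-! ### §1 Cutoffs -/

/-- The lateral cutoff `ψ₁(t) = λ((t - (1+2s)²)/((1+3s)² - (1+2s)²))`: `0` for `t ≤ (1+2s)²`, `1`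
for `t ≥ (1+3s)²`, nondecreasing. [folklore] -/
def latCutoff (s t : ℝ) : ℝ :=
  Real.smoothTransition ((t - (1 + 2 * s) ^ 2) / ((1 + 3 * s) ^ 2 - (1 + 2 * s) ^ 2))

/-- The vertical cutoff `ψ₂(z) = λ((z - 2s)/s) + λ((-5s - z)/s)`: `0` on `[-5s, 2s]`, `1` off
`(-6s, 3s)`. [folklore] -/
def vertCutoff (s z : ℝ) : ℝ :=
  Real.smoothTransition ((z - 2 * s) / s) + Real.smoothTransition ((-5 * s - z) / s)

/-- **The push cutoff** `ψ = ψ₁(ρ²) + ψ₂(x₂) - ψ₁(ρ²)ψ₂(x₂)`: `0` on the box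
`BX = {ρ² ≤ (1+2s)², -5s ≤ x₂ ≤ 2s}`, `1` off `BX' = {ρ² < (1+3s)², -6s < x₂ < 3s}`, with
horizontal gradient a nonnegative multiple of the horizontal position. [folklore] -/
def pushCutoff (s : ℝ) (x : EuclideanSpace ℝ (Fin 3)) : ℝ :=
  latCutoff s (hsq x) + vertCutoff s (x 2) - latCutoff s (hsq x) * vertCutoff s (x 2)

/-- **The collar cutoff** `χ_c(z) = λ((z + 4s)/s)`: `0` for `z ≤ -4s`, `1` for `z ≥ -3s`.
[folklore] -/
def collarCutoff (s z : ℝ) : ℝ := Real.smoothTransition ((z + 4 * s) / s)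

/-- The lower blend cutoff `λ((z + 3s)/(s/2))`: `0` for `z ≤ -3s`, `1` for `z ≥ -5s/2`.
[folklore] -/
def loCutoff (s z : ℝ) : ℝ := Real.smoothTransition ((z + 3 * s) / (s / 2))

/-- The upper blend cutoff `λ((2s - z)/(s/2))`: `1` for `z ≤ 3s/2`, `0` for `z ≥ 2s`. [folklore] -/
def hiCutoff (s z : ℝ) : ℝ := Real.smoothTransition ((2 * s - z) / (s / 2))

/-- The lateral blend cutoff `λ(((1+3s)² - t)/((1+3s)² - (1+2s)²))`: `1` for `t ≤ (1+2s)²`, `0`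
for `t ≥ (1+3s)²`. [folklore] -/
def latBlend (s t : ℝ) : ℝ :=
  Real.smoothTransition (((1 + 3 * s) ^ 2 - t) / ((1 + 3 * s) ^ 2 - (1 + 2 * s) ^ 2))

/-- **The blend weight** `β(x) = χ_lo(x₂) χ_hi(x₂) χ_lat(ρ²)`: `1` on the lid zone
`LZ = {ρ² ≤ (1+2s)², -5s/2 ≤ x₂ ≤ 3s/2}`, `0` off `LZ' = {ρ² < (1+3s)², -3s < x₂ < 2s}`.
[folklore] -/
def blendWeight (s : ℝ) (x : EuclideanSpace ℝ (Fin 3)) : ℝ :=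
  loCutoff s (x 2) * hiCutoff s (x 2) * latBlend s (hsq x)

/-! ### §2 The fill weight, the filled defining function, the sub-sphere function, the domain -/

/-- **The fill weight** `w = 1 + G + 2δ(1 - χ_c(x₂)) + M ψ(x)`: its unit sublevel set `{w ≤ 1}`
is (up to the rounding `δ`) the rim collar `{G ≤ 0}` of the lid solid, cut off below `x₂ = -4s`
(where `w - 1 ≥ G + 2δ`, so that the smooth minimum with the straightened defining function
`G = ρ² - 1 = F` there is exactly `F`) and pushed up by `M` off the box `BX`. [folklore] -/
def fillWeight (P : ℝ → ℝ) (s δ M : ℝ) (x : EuclideanSpace ℝ (Fin 3)) : ℝ :=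
  1 + lidFun P s x + 2 * δ * (1 - collarCutoff s (x 2)) + M * pushCutoff s x

/-- **The filled defining function** `F₂ = F ⊓_δ (w - 1) = F - δ P((F - (w - 1))/δ)` (the smooth
minimum of `FillLemma.lean`): `{F₂ ≤ 0}` is the solid `A = {F ≤ 0}` with the rim collar of the lid
added and the corners rounded — the region onto which the fill lemma's diffeomorphism maps `A`.
[folklore] -/
def fillFun (F : EuclideanSpace ℝ (Fin 3) → ℝ) (P : ℝ → ℝ) (s δ M : ℝ)
    (x : EuclideanSpace ℝ (Fin 3)) : ℝ :=
  F x - δ * P ((F x - (fillWeight P s δ M x - 1)) / δ)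

/-- **The sub-sphere function** `G_B = β G + (1 - β) F₂`: the lid function on the lid zone,
the filled defining function off it.  Its zero set inside the domain `subDomain` is the smoothed
sphere `D ∪ D₁` of the printed proof (Schultens (2014), PDF p. 45).
[cite: Schultens2014, proof of Thm. 3.2.5 (PDF p. 45)] -/
def subFun (F : EuclideanSpace ℝ (Fin 3) → ℝ) (P : ℝ → ℝ) (s δ M : ℝ)
    (x : EuclideanSpace ℝ (Fin 3)) : ℝ :=
  blendWeight s x * lidFun P s x + (1 - blendWeight s x) * fillFun F P s δ M x

/-- The open box `BXo = {ρ² < (1+3s)², -3s < x₂ < η}` around the lid and the upper wall.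
[folklore] -/
def openBox (s η : ℝ) : Set (EuclideanSpace ℝ (Fin 3)) :=
  {x | hsq x < (1 + 3 * s) ^ 2 ∧ -3 * s < x 2 ∧ x 2 < η}

/-- The first plug `T₁ = E₁ ∖ BXo`: the non-absorbed disc of the sphere away from the box.
[folklore] -/
def plugOne (E₁ : Set (EuclideanSpace ℝ (Fin 3))) (s η : ℝ) : Set (EuclideanSpace ℝ (Fin 3)) :=
  E₁ \ openBox s η

/-- The second plug `T₂ = {ρ² ≤ (1+3s)², 3s/2 ≤ x₂ ≤ η}`: the pillbox above the dome where the lid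
function and the filled defining function have opposite signs. [folklore] -/
def plugTwo (s η : ℝ) : Set (EuclideanSpace ℝ (Fin 3)) :=
  {x | hsq x ≤ (1 + 3 * s) ^ 2 ∧ 3 * s / 2 ≤ x 2 ∧ x 2 ≤ η}

/-- **The domain of the sub-sphere function**: the complement of the two plugs.  The sub-sphere
is `{x ∈ subDomain | G_B x = 0}`. [folklore] -/
def subDomain (E₁ : Set (EuclideanSpace ℝ (Fin 3))) (s η : ℝ) : Set (EuclideanSpace ℝ (Fin 3)) :=
  (plugOne E₁ s η ∪ plugTwo s η)ᶜ

/-- The closed box `{ρ² ≤ (1+3s)², -6s ≤ x₂ ≤ 3s}` (the closure of `BX'`): all the moves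
of the step before the absorption happen inside it. [folklore] -/
def closedBox (s : ℝ) : Set (EuclideanSpace ℝ (Fin 3)) :=
  {x | hsq x ≤ (1 + 3 * s) ^ 2 ∧ -6 * s ≤ x 2 ∧ x 2 ≤ 3 * s}

/-- **The sub-sphere** `W = {x ∈ subDomain E₁ s (4s) | G_B x = 0}` (with the push height
`M = (1+s)² + ε₀ + 2` of the collar fill and box height `η = 4s`): the smoothed sphere `D ∪ D₁`
of the printed proof (Schultens (2014), PDF p. 45).
[cite: Schultens2014, proof of Thm. 3.2.5 (PDF p. 45)] -/
def subSphere (F : EuclideanSpace ℝ (Fin 3) → ℝ) (P : ℝ → ℝ) (E₁ : Set (EuclideanSpace ℝ (Fin 3)))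
    (s δ ε₀ : ℝ) : Set (EuclideanSpace ℝ (Fin 3)) :=
  {x | x ∈ subDomain E₁ s (4 * s) ∧ subFun F P s δ ((1 + s) ^ 2 + ε₀ + 2) x = 0}

/-- The lid piece `{G = 0, x₂ ≥ -3s}` of the sub-sphere: dome, top annulus, rim, and the upper
part of the collar. [folklore] -/
def lidPiece (P : ℝ → ℝ) (s : ℝ) : Set (EuclideanSpace ℝ (Fin 3)) :=
  {x | lidFun P s x = 0 ∧ -3 * s ≤ x 2}

/-- The low piece `{F₂ = 0, x₂ ≤ -5s/2} ∩ closedBox` of the sub-sphere: the part of the boundary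
of the filled solid in the lower box (lower collar, its junction with the wall, lower wall).
[folklore] -/
def lowPiece (F : EuclideanSpace ℝ (Fin 3) → ℝ) (P : ℝ → ℝ) (s δ ε₀ : ℝ) :
    Set (EuclideanSpace ℝ (Fin 3)) :=
  {x | fillFun F P s δ ((1 + s) ^ 2 + ε₀ + 2) x = 0 ∧ x 2 ≤ -(5 * s / 2) ∧ x ∈ closedBox s}

/-- **Admissible smooth positive parts** `P` (`SmoothMax.exists_smoothPosPart`): smooth, `0` on
`(-∞, -1]`, the identity on `[1, ∞)`, `0 ≤ P' ≤ 1`, `max 0 t ≤ P t ≤ max 0 t + 1`. [folklore] -/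
structure Admissible (P : ℝ → ℝ) : Prop where
  /-- smooth -/
  hP : ContDiff ℝ ∞ P
  /-- zero on `(-∞, -1]` -/
  hP0 : ∀ t, t ≤ -1 → P t = 0
  /-- the identity on `[1, ∞)` -/
  hP1 : ∀ t, 1 ≤ t → P t = t
  /-- `0 ≤ P' ≤ 1` -/
  hPd : ∀ t, 0 ≤ deriv P t ∧ deriv P t ≤ 1
  /-- `max 0 t ≤ P t` -/
  hPge : ∀ t, max 0 t ≤ P t
  /-- `P t ≤ max 0 t + 1` -/
  hPle : ∀ t, P t ≤ max 0 t + 1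

/-- Admissible positive parts exist. [folklore] -/
theorem Admissible.exists : ∃ P : ℝ → ℝ, Admissible P := by
  obtain ⟨P, h1, h2, h3, h4, h5, h6⟩ := SmoothMax.exists_smoothPosPart
  exact ⟨P, ⟨h1, h2, h3, h4, h5, h6⟩⟩

/-- An admissible positive part is differentiable. [folklore] -/
theorem Admissible.differentiable {P : ℝ → ℝ} (h : Admissible P) : Differentiable ℝ P :=
  h.hP.differentiable (by simp)

/-- **Normal-form data of the capped-ball step** (case IN, absorbed side lower): the defining
function `F` of the solid `A = {F ≤ 0}` is smooth with `{F ≤ ε₀}` compact and regular zero set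
`Z = {F = 0} = E₁ ∪ E₂` (two closed sets, the two discs of the sphere cut along the unit circle at
height `0`, meeting only along it); on the box `{ρ² ≤ (1 + 3w₀)², |x₂| ≤ η₀}` around the vertical
unit cylinder `F = ρ² - 1` exactly (so the sphere meets the box in the cylinder wall, the solid in
the solid cylinder); inside the box `E₁` lies at heights `≥ 0` and `E₂` at heights `≤ 0`.
[folklore] -/
structure StepNF (F : EuclideanSpace ℝ (Fin 3) → ℝ) (E₁ E₂ : Set (EuclideanSpace ℝ (Fin 3)))
    (w₀ η₀ ε₀ : ℝ) : Prop where
  /-- smooth -/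
  hF : ContDiff ℝ ∞ F
  /-- `ε₀ > 0` -/
  hε₀ : 0 < ε₀
  /-- a compact sublevel set above `0` -/
  hKε : IsCompact {x | F x ≤ ε₀}
  /-- regular zero set -/
  hreg : ∀ x, F x = 0 → fderiv ℝ F x ≠ 0
  /-- `w₀ > 0` -/
  hw₀ : 0 < w₀
  /-- straightened on the box: `F = ρ² - 1` there -/
  hNF : ∀ x, hsq x ≤ (1 + 3 * w₀) ^ 2 → |x 2| ≤ η₀ → F x = hsq x - 1
  /-- `E₁` closed -/
  hE₁ : IsClosed E₁
  /-- `E₂` closed -/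
  hE₂ : IsClosed E₂
  /-- the zero set is `E₁ ∪ E₂` -/
  hZ : {x | F x = 0} = E₁ ∪ E₂
  /-- the two discs meet only along the unit circle at height `0` -/
  hE₁₂ : E₁ ∩ E₂ ⊆ {x | hsq x = 1 ∧ x 2 = 0}
  /-- in the box `E₁` lies above height `0` -/
  hE₁box : ∀ x ∈ E₁, hsq x ≤ (1 + 3 * w₀) ^ 2 → |x 2| ≤ η₀ → 0 ≤ x 2
  /-- in the box `E₂` lies below height `0` -/
  hE₂box : ∀ x ∈ E₂, hsq x ≤ (1 + 3 * w₀) ^ 2 → |x 2| ≤ η₀ → x 2 ≤ 0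

/-- **Scales of the capped-ball step**: the lid scale `s`, the rounding width `δ`, against the
shell width `w₀` and box height `η₀` of the normal form. [folklore] -/
structure StepScale (s δ w₀ η₀ : ℝ) : Prop where
  /-- `s > 0` -/
  hs : 0 < s
  /-- `s ≤ 1/8` -/
  hs1 : s ≤ 1 / 8
  /-- `8s ≤ w₀` -/
  hsw : 8 * s ≤ w₀
  /-- `20s ≤ η₀` -/
  hsη : 20 * s ≤ η₀
  /-- `δ > 0` -/
  hδ : 0 < δ
  /-- `δ ≤ s/16` -/
  hδs : δ ≤ s / 16

namespace StepNF

variable {F : EuclideanSpace ℝ (Fin 3) → ℝ} {E₁ E₂ : Set (EuclideanSpace ℝ (Fin 3))}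
  {w₀ η₀ ε₀ : ℝ}

/-- The shell form of the normal form: `F = ρ² - 1` on `{|ρ² - 1| ≤ w₀, |x₂| ≤ η₀}`.
[folklore] -/
theorem hNFa (h : StepNF F E₁ E₂ w₀ η₀ ε₀) :
    ∀ x, |hsq x - 1| ≤ w₀ → |x 2| ≤ η₀ → F x = hsq x - 1 := fun x hx hz =>
  h.hNF x (by have := (abs_le.1 hx).2; nlinarith [h.hw₀]) hz

/-- `F < 0` inside the cylinder, within the box. [folklore] -/
theorem hNFb (h : StepNF F E₁ E₂ w₀ η₀ ε₀) : ∀ x, hsq x < 1 → |x 2| ≤ η₀ → F x < 0 :=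
  fun x hx hz => by rw [h.hNF x (by nlinarith [h.hw₀]) hz]; linarith

/-- `F > 0` outside the cylinder, within the box. [folklore] -/
theorem hNFc (h : StepNF F E₁ E₂ w₀ η₀ ε₀) :
    ∀ x, 1 < hsq x → hsq x ≤ (1 + 3 * w₀) ^ 2 → |x 2| ≤ η₀ → 0 < F x :=
  fun x hx hx' hz => by rw [h.hNF x hx' hz]; linarith

/-- **The sphere meets the box in the cylinder wall**: a zero of `F` in the box has `ρ² = 1`.
[folklore] -/
theorem hsq_eq_one (h : StepNF F E₁ E₂ w₀ η₀ ε₀) {x : EuclideanSpace ℝ (Fin 3)} (hx : F x = 0)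
    (h1 : hsq x ≤ (1 + 3 * w₀) ^ 2) (h2 : |x 2| ≤ η₀) : hsq x = 1 := by
  rw [h.hNF x h1 h2] at hx; linarith

/-- Points of `E₁` are zeros of `F`. [folklore] -/
theorem eq_zero_of_mem_left (h : StepNF F E₁ E₂ w₀ η₀ ε₀) {x : EuclideanSpace ℝ (Fin 3)}
    (hx : x ∈ E₁) : F x = 0 := by
  have : x ∈ {x | F x = 0} := by rw [h.hZ]; exact Or.inl hx
  exact this

/-- Points of `E₂` are zeros of `F`. [folklore] -/
theorem eq_zero_of_mem_right (h : StepNF F E₁ E₂ w₀ η₀ ε₀) {x : EuclideanSpace ℝ (Fin 3)}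
    (hx : x ∈ E₂) : F x = 0 := by
  have : x ∈ {x | F x = 0} := by rw [h.hZ]; exact Or.inr hx
  exact this

end StepNF

/-! ### §3 Values of the cutoffs -/

section Cutoffs

/-- `ψ₁ ∈ [0, 1]`. [folklore] -/
theorem latCutoff_mem_Icc (t : ℝ) : latCutoff s t ∈ Icc (0 : ℝ) 1 :=
  ⟨Real.smoothTransition.nonneg _, Real.smoothTransition.le_one _⟩

/-- `ψ₁ = 0` for `t ≤ (1+2s)²`. [folklore] -/
theorem latCutoff_eq_zero (hs : 0 < s) {t : ℝ} (ht : t ≤ (1 + 2 * s) ^ 2) : latCutoff s t = 0 := by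
  unfold latCutoff
  apply Real.smoothTransition.zero_of_nonpos
  apply div_nonpos_of_nonpos_of_nonneg (by linarith)
  nlinarith

/-- `ψ₁ = 1` for `t ≥ (1+3s)²`. [folklore] -/
theorem latCutoff_eq_one (hs : 0 < s) {t : ℝ} (ht : (1 + 3 * s) ^ 2 ≤ t) : latCutoff s t = 1 := by
  unfold latCutoff
  apply Real.smoothTransition.one_of_one_le
  rw [le_div_iff₀ (by nlinarith)]
  linarith

/-- `ψ₁` is nondecreasing. [folklore] -/
theorem latCutoff_monotone (hs : 0 < s) : Monotone (latCutoff s) := fun a b hab => by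
  unfold latCutoff
  exact Real.smoothTransition.monotone (div_le_div_of_nonneg_right (by linarith) (by nlinarith))

/-- `ψ₂ ∈ [0, 1]`. [folklore] -/
theorem vertCutoff_mem_Icc (hs : 0 < s) (z : ℝ) : vertCutoff s z ∈ Icc (0 : ℝ) 1 := by
  unfold vertCutoff
  refine ⟨add_nonneg (Real.smoothTransition.nonneg _) (Real.smoothTransition.nonneg _), ?_⟩
  rcases le_or_gt (-5 * s) z with h | h
  · rw [Real.smoothTransition.zero_of_nonpos (x := (-5 * s - z) / s)
      (div_nonpos_of_nonpos_of_nonneg (by linarith) hs.le), add_zero]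
    exact Real.smoothTransition.le_one _
  · rw [Real.smoothTransition.zero_of_nonpos (x := (z - 2 * s) / s)
      (div_nonpos_of_nonpos_of_nonneg (by linarith) hs.le), zero_add]
    exact Real.smoothTransition.le_one _

/-- `ψ₂ = 0` on `[-5s, 2s]`. [folklore] -/
theorem vertCutoff_eq_zero (hs : 0 < s) {z : ℝ} (h1 : -5 * s ≤ z) (h2 : z ≤ 2 * s) : vertCutoff s z = 0 := by
  unfold vertCutoff
  rw [Real.smoothTransition.zero_of_nonpos (div_nonpos_of_nonpos_of_nonneg (by linarith) hs.le),
    Real.smoothTransition.zero_of_nonpos (div_nonpos_of_nonpos_of_nonneg (by linarith) hs.le),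
    add_zero]

/-- `ψ₂ = 1` for `z ≥ 3s`. [folklore] -/
theorem vertCutoff_eq_one_of_le (hs : 0 < s) {z : ℝ} (h : 3 * s ≤ z) : vertCutoff s z = 1 := by
  unfold vertCutoff
  rw [Real.smoothTransition.one_of_one_le (by rw [le_div_iff₀ hs]; linarith),
    Real.smoothTransition.zero_of_nonpos (div_nonpos_of_nonpos_of_nonneg (by linarith) hs.le),
    add_zero]

/-- `ψ₂ = 1` for `z ≤ -6s`. [folklore] -/
theorem vertCutoff_eq_one_of_ge (hs : 0 < s) {z : ℝ} (h : z ≤ -6 * s) : vertCutoff s z = 1 := by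
  unfold vertCutoff
  rw [Real.smoothTransition.zero_of_nonpos (div_nonpos_of_nonpos_of_nonneg (by linarith) hs.le),
    Real.smoothTransition.one_of_one_le (by rw [le_div_iff₀ hs]; linarith), zero_add]

/-- **`ψ ∈ [0, 1]`.** [folklore] -/
theorem pushCutoff_mem_Icc (hs : 0 < s) (x : EuclideanSpace ℝ (Fin 3)) : pushCutoff s x ∈ Icc (0 : ℝ) 1 := by
  unfold pushCutoff
  obtain ⟨a0, a1⟩ := latCutoff_mem_Icc (s := s) (hsq x)
  obtain ⟨b0, b1⟩ := vertCutoff_mem_Icc hs (x 2)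
  constructor <;> nlinarith [mul_nonneg a0 b0, mul_nonneg (sub_nonneg.2 a1) (sub_nonneg.2 b1)]

/-- **`ψ = 0` on the box `BX`.** [folklore] -/
theorem pushCutoff_eq_zero (hs : 0 < s) {x : EuclideanSpace ℝ (Fin 3)} (h1 : hsq x ≤ (1 + 2 * s) ^ 2)
    (h2 : -5 * s ≤ x 2) (h3 : x 2 ≤ 2 * s) : pushCutoff s x = 0 := by
  unfold pushCutoff
  rw [latCutoff_eq_zero hs h1, vertCutoff_eq_zero hs h2 h3]
  ring

/-- **`ψ = 1` off the box `BX'`.** [folklore] -/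
theorem pushCutoff_eq_one (hs : 0 < s) {x : EuclideanSpace ℝ (Fin 3)}
    (h : (1 + 3 * s) ^ 2 ≤ hsq x ∨ x 2 ≤ -6 * s ∨ 3 * s ≤ x 2) : pushCutoff s x = 1 := by
  unfold pushCutoff
  rcases h with h | h | h
  · rw [latCutoff_eq_one hs h]; ring
  · rw [vertCutoff_eq_one_of_ge hs h]; ring
  · rw [vertCutoff_eq_one_of_le hs h]; ring

/-- `χ_c ∈ [0, 1]`. [folklore] -/
theorem collarCutoff_mem_Icc (z : ℝ) : collarCutoff s z ∈ Icc (0 : ℝ) 1 :=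
  ⟨Real.smoothTransition.nonneg _, Real.smoothTransition.le_one _⟩

/-- `χ_c = 0` for `z ≤ -4s`. [folklore] -/
theorem collarCutoff_eq_zero (hs : 0 < s) {z : ℝ} (h : z ≤ -4 * s) : collarCutoff s z = 0 :=
  Real.smoothTransition.zero_of_nonpos (div_nonpos_of_nonpos_of_nonneg (by linarith) hs.le)

/-- `χ_c = 1` for `z ≥ -3s`. [folklore] -/
theorem collarCutoff_eq_one (hs : 0 < s) {z : ℝ} (h : -3 * s ≤ z) : collarCutoff s z = 1 :=
  Real.smoothTransition.one_of_one_le (by rw [le_div_iff₀ hs]; linarith)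

/-- `β ∈ [0, 1]`. [folklore] -/
theorem blendWeight_mem_Icc (x : EuclideanSpace ℝ (Fin 3)) : blendWeight s x ∈ Icc (0 : ℝ) 1 := by
  unfold blendWeight loCutoff hiCutoff latBlend
  set a := Real.smoothTransition ((x 2 + 3 * s) / (s / 2))
  set b := Real.smoothTransition ((2 * s - x 2) / (s / 2))
  set c := Real.smoothTransition (((1 + 3 * s) ^ 2 - hsq x) / ((1 + 3 * s) ^ 2 - (1 + 2 * s) ^ 2))
  have ha : a ∈ Icc (0:ℝ) 1 := ⟨Real.smoothTransition.nonneg _, Real.smoothTransition.le_one _⟩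
  have hb : b ∈ Icc (0:ℝ) 1 := ⟨Real.smoothTransition.nonneg _, Real.smoothTransition.le_one _⟩
  have hc : c ∈ Icc (0:ℝ) 1 := ⟨Real.smoothTransition.nonneg _, Real.smoothTransition.le_one _⟩
  have hab : a * b ∈ Icc (0:ℝ) 1 := ⟨mul_nonneg ha.1 hb.1, mul_le_one₀ ha.2 hb.1 hb.2⟩
  exact ⟨mul_nonneg hab.1 hc.1, mul_le_one₀ hab.2 hc.1 hc.2⟩

/-- **`β = 1` on the lid zone `LZ`.** [folklore] -/
theorem blendWeight_eq_one (hs : 0 < s) {x : EuclideanSpace ℝ (Fin 3)} (h1 : hsq x ≤ (1 + 2 * s) ^ 2)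
    (h2 : -(5 * s / 2) ≤ x 2) (h3 : x 2 ≤ 3 * s / 2) : blendWeight s x = 1 := by
  unfold blendWeight loCutoff hiCutoff latBlend
  rw [Real.smoothTransition.one_of_one_le (by rw [le_div_iff₀ (by positivity)]; linarith),
    Real.smoothTransition.one_of_one_le (by rw [le_div_iff₀ (by positivity)]; linarith),
    Real.smoothTransition.one_of_one_le (by rw [le_div_iff₀ (by nlinarith)]; nlinarith)]
  ring

/-- **`β = 0` off `LZ'`.** [folklore] -/
theorem blendWeight_eq_zero (hs : 0 < s) {x : EuclideanSpace ℝ (Fin 3)}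
    (h : (1 + 3 * s) ^ 2 ≤ hsq x ∨ x 2 ≤ -3 * s ∨ 2 * s ≤ x 2) : blendWeight s x = 0 := by
  unfold blendWeight loCutoff hiCutoff latBlend
  rcases h with h | h | h
  · rw [Real.smoothTransition.zero_of_nonpos (x := ((1 + 3 * s) ^ 2 - hsq x) / _)
      (div_nonpos_of_nonpos_of_nonneg (by linarith) (by nlinarith))]
    ring
  · rw [Real.smoothTransition.zero_of_nonpos (x := (x 2 + 3 * s) / (s / 2))
      (div_nonpos_of_nonpos_of_nonneg (by linarith) (by positivity))]
    ring
  · rw [Real.smoothTransition.zero_of_nonpos (x := (2 * s - x 2) / (s / 2))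
      (div_nonpos_of_nonpos_of_nonneg (by linarith) (by positivity))]
    ring

end Cutoffs

/-! ### §4 Smoothness -/

/-- `ψ₁` is smooth. [folklore] -/
theorem contDiff_latCutoff : ContDiff ℝ ∞ (latCutoff s) :=
  Real.smoothTransition.contDiff.comp ((contDiff_id.sub contDiff_const).div_const _)

/-- `ψ₂` is smooth. [folklore] -/
theorem contDiff_vertCutoff : ContDiff ℝ ∞ (vertCutoff s) :=
  (Real.smoothTransition.contDiff.comp ((contDiff_id.sub contDiff_const).div_const _)).add
    (Real.smoothTransition.contDiff.comp ((contDiff_const.sub contDiff_id).div_const _))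

/-- `ψ` is smooth. [folklore] -/
theorem contDiff_pushCutoff : ContDiff ℝ ∞ (pushCutoff s) := by
  have h1 : ContDiff ℝ ∞ fun x : EuclideanSpace ℝ (Fin 3) => latCutoff s (hsq x) :=
    contDiff_latCutoff.comp contDiff_hsq
  have h2 : ContDiff ℝ ∞ fun x : EuclideanSpace ℝ (Fin 3) => vertCutoff s (x 2) :=
    contDiff_vertCutoff.comp (contDiff_coord 2)
  unfold pushCutoff
  exact (h1.add h2).sub (h1.mul h2)

/-- `χ_c` is smooth. [folklore] -/
theorem contDiff_collarCutoff : ContDiff ℝ ∞ (collarCutoff s) :=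
  Real.smoothTransition.contDiff.comp ((contDiff_id.add contDiff_const).div_const _)

/-- `β` is smooth. [folklore] -/
theorem contDiff_blendWeight : ContDiff ℝ ∞ (blendWeight s) := by
  have h1 : ContDiff ℝ ∞ fun x : EuclideanSpace ℝ (Fin 3) => loCutoff s (x 2) :=
    (Real.smoothTransition.contDiff.comp ((contDiff_id.add contDiff_const).div_const _)).comp
      (contDiff_coord 2)
  have h2 : ContDiff ℝ ∞ fun x : EuclideanSpace ℝ (Fin 3) => hiCutoff s (x 2) :=
    (Real.smoothTransition.contDiff.comp ((contDiff_const.sub contDiff_id).div_const _)).comp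
      (contDiff_coord 2)
  have h3 : ContDiff ℝ ∞ fun x : EuclideanSpace ℝ (Fin 3) => latBlend s (hsq x) :=
    (Real.smoothTransition.contDiff.comp ((contDiff_const.sub contDiff_id).div_const _)).comp
      contDiff_hsq
  unfold blendWeight
  exact (h1.mul h2).mul h3

/-- **The fill weight is smooth.** [folklore] -/
theorem contDiff_fillWeight (hP : ContDiff ℝ ∞ P) : ContDiff ℝ ∞ (fillWeight P s δ M) := by
  unfold fillWeight
  exact ((contDiff_const.add (contDiff_lidFun hP)).add (contDiff_const.mul
    (contDiff_const.sub (contDiff_collarCutoff.comp (contDiff_coord 2))))).add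
    (contDiff_const.mul contDiff_pushCutoff)

/-- **The filled defining function is smooth** (for smooth `F`, `P`). [folklore] -/
theorem contDiff_fillFun {F : EuclideanSpace ℝ (Fin 3) → ℝ} (hF : ContDiff ℝ ∞ F)
    (hP : ContDiff ℝ ∞ P) : ContDiff ℝ ∞ (fillFun F P s δ M) := by
  unfold fillFun
  exact hF.sub (contDiff_const.mul (hP.comp ((hF.sub ((contDiff_fillWeight hP).sub
    contDiff_const)).div_const _)))

/-- **The sub-sphere function is smooth.** [folklore] -/
theorem contDiff_subFun {F : EuclideanSpace ℝ (Fin 3) → ℝ} (hF : ContDiff ℝ ∞ F)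
    (hP : ContDiff ℝ ∞ P) : ContDiff ℝ ∞ (subFun F P s δ M) := by
  unfold subFun
  exact (contDiff_blendWeight.mul (contDiff_lidFun hP)).add
    ((contDiff_const.sub contDiff_blendWeight).mul (contDiff_fillFun hF hP))

/-! ### §5 Values of the fill weight, the filled function, the sub-sphere function -/

section Values

/-- The fill weight dominates `1 + G` (`δ, M ≥ 0`). [folklore] -/
theorem one_add_lidFun_le_fillWeight (hs : 0 < s) (hδ : 0 ≤ δ) (hM : 0 ≤ M) (x : EuclideanSpace ℝ (Fin 3)) :
    1 + lidFun P s x ≤ fillWeight P s δ M x := by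
  unfold fillWeight
  have h1 := (collarCutoff_mem_Icc (s := s) (x 2)).2
  have h2 := (pushCutoff_mem_Icc hs x).1
  nlinarith [mul_nonneg hM h2, mul_nonneg hδ (sub_nonneg.2 h1)]

/-- On the box `BX` above `x₂ = -3s` the fill weight is `1 + G`. [folklore] -/
theorem fillWeight_eq_of_mem_box (hs : 0 < s) {x : EuclideanSpace ℝ (Fin 3)} (h1 : hsq x ≤ (1 + 2 * s) ^ 2)
    (h2 : -3 * s ≤ x 2) (h3 : x 2 ≤ 2 * s) : fillWeight P s δ M x = 1 + lidFun P s x := by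
  unfold fillWeight
  rw [collarCutoff_eq_one hs h2, pushCutoff_eq_zero hs h1 (by linarith) h3]
  ring

/-- On the box `BX` below `x₂ = -4s` the fill weight is `1 + G + 2δ`. [folklore] -/
theorem fillWeight_eq_of_le (hs : 0 < s) {x : EuclideanSpace ℝ (Fin 3)} (h1 : hsq x ≤ (1 + 2 * s) ^ 2)
    (h2 : -5 * s ≤ x 2) (h3 : x 2 ≤ -4 * s) :
    fillWeight P s δ M x = 1 + lidFun P s x + 2 * δ := by
  unfold fillWeight
  rw [collarCutoff_eq_zero hs h3, pushCutoff_eq_zero hs h1 h2 (by linarith)]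
  ring

/-- Off the box `BX'` the fill weight is at least `1 + G + M`. [folklore] -/
theorem fillWeight_ge_of_not_mem (hs : 0 < s) (hδ : 0 ≤ δ) {x : EuclideanSpace ℝ (Fin 3)}
    (h : (1 + 3 * s) ^ 2 ≤ hsq x ∨ x 2 ≤ -6 * s ∨ 3 * s ≤ x 2) :
    1 + lidFun P s x + M ≤ fillWeight P s δ M x := by
  unfold fillWeight
  rw [pushCutoff_eq_one hs h]
  have h1 := (collarCutoff_mem_Icc (s := s) (x 2)).2
  nlinarith [mul_nonneg hδ (sub_nonneg.2 h1)]

/-- **The lid function is bounded below by `-(1+s)²`** (it dominates the rim argument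
`ρ² - (1 + r)²`). [folklore] -/
theorem neg_sq_le_lidFun (hs : 0 < s) (hPge : ∀ t, max 0 t ≤ P t) (x : EuclideanSpace ℝ (Fin 3)) :
    -(1 + s) ^ 2 ≤ lidFun P s x := by
  have h := (le_max_right _ _).trans (max_le_lidFun hPge hs x)
  unfold rimFun at h
  have h0 := rimRadius_nonneg hs (x 2)
  have h1 := rimRadius_le hs (x 2)
  nlinarith [hsq_nonneg x]

/-- The filled function is at most both `F` and `w - 1` (smooth minimum). [folklore] -/
theorem fillFun_le_min (hPge : ∀ t, max 0 t ≤ P t) (hδ : 0 < δ)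
    {F : EuclideanSpace ℝ (Fin 3) → ℝ} (x : EuclideanSpace ℝ (Fin 3)) :
    fillFun F P s δ M x ≤ min (F x) (fillWeight P s δ M x - 1) := by
  unfold fillFun
  exact SmoothMax.smin_le_min hPge hδ _ _

/-- The filled function is at least the minimum minus `δ`. [folklore] -/
theorem min_sub_le_fillFun (hPle : ∀ t, P t ≤ max 0 t + 1) (hδ : 0 < δ)
    {F : EuclideanSpace ℝ (Fin 3) → ℝ} (x : EuclideanSpace ℝ (Fin 3)) :
    min (F x) (fillWeight P s δ M x - 1) - δ ≤ fillFun F P s δ M x := by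
  unfold fillFun
  exact SmoothMax.min_sub_le_smin hPle hδ _ _

/-- **Where `w - 1 ≥ F + δ` the filled function is `F`.** [folklore] -/
theorem fillFun_eq_left (hP0 : ∀ t, t ≤ -1 → P t = 0) (hδ : 0 < δ)
    {F : EuclideanSpace ℝ (Fin 3) → ℝ} {x : EuclideanSpace ℝ (Fin 3)}
    (h : F x ≤ (fillWeight P s δ M x - 1) - δ) : fillFun F P s δ M x = F x := by
  unfold fillFun
  exact SmoothMax.smin_eq_left hP0 hδ h

/-- **Where `F ≥ (w - 1) + δ` the filled function is `w - 1`.** [folklore] -/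
theorem fillFun_eq_right (hP1 : ∀ t, 1 ≤ t → P t = t) (hδ : 0 < δ)
    {F : EuclideanSpace ℝ (Fin 3) → ℝ} {x : EuclideanSpace ℝ (Fin 3)}
    (h : fillWeight P s δ M x - 1 ≤ F x - δ) : fillFun F P s δ M x = fillWeight P s δ M x - 1 := by
  unfold fillFun
  exact SmoothMax.smin_eq_right hP1 hδ h

/-- On the lid zone the sub-sphere function is the lid function. [folklore] -/
theorem subFun_eq_lidFun (hs : 0 < s) {F : EuclideanSpace ℝ (Fin 3) → ℝ} {x : EuclideanSpace ℝ (Fin 3)}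
    (h1 : hsq x ≤ (1 + 2 * s) ^ 2) (h2 : -(5 * s / 2) ≤ x 2) (h3 : x 2 ≤ 3 * s / 2) :
    subFun F P s δ M x = lidFun P s x := by
  unfold subFun
  rw [blendWeight_eq_one hs h1 h2 h3]
  ring

/-- Off `LZ'` the sub-sphere function is the filled function. [folklore] -/
theorem subFun_eq_fillFun (hs : 0 < s) {F : EuclideanSpace ℝ (Fin 3) → ℝ} {x : EuclideanSpace ℝ (Fin 3)}
    (h : (1 + 3 * s) ^ 2 ≤ hsq x ∨ x 2 ≤ -3 * s ∨ 2 * s ≤ x 2) :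
    subFun F P s δ M x = fillFun F P s δ M x := by
  unfold subFun
  rw [blendWeight_eq_zero hs h]
  ring

/-- Where the lid function and the filled function agree, the sub-sphere function is that
common value (whatever the weight). [folklore] -/
theorem subFun_eq_of_eq {F : EuclideanSpace ℝ (Fin 3) → ℝ} {x : EuclideanSpace ℝ (Fin 3)}
    (h : fillFun F P s δ M x = lidFun P s x) : subFun F P s δ M x = lidFun P s x := by
  unfold subFun
  rw [h]
  ring

/-- A convex combination of two negative numbers is negative: where both the lid function and
the filled function are negative, so is the sub-sphere function. [folklore] -/
theorem subFun_neg_of_neg {F : EuclideanSpace ℝ (Fin 3) → ℝ} {x : EuclideanSpace ℝ (Fin 3)}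
    (h1 : lidFun P s x < 0) (h2 : fillFun F P s δ M x < 0) : subFun F P s δ M x < 0 := by
  unfold subFun
  obtain ⟨b0, b1⟩ := blendWeight_mem_Icc (s := s) x
  rcases b0.lt_or_eq with hb | hb
  · nlinarith [mul_nonneg (sub_nonneg.2 b1) (neg_nonneg.2 h2.le)]
  · rw [← hb]; simpa using h2

/-- Where both the lid function and the filled function are positive, so is the sub-sphere
function. [folklore] -/
theorem subFun_pos_of_pos {F : EuclideanSpace ℝ (Fin 3) → ℝ} {x : EuclideanSpace ℝ (Fin 3)}
    (h1 : 0 < lidFun P s x) (h2 : 0 < fillFun F P s δ M x) : 0 < subFun F P s δ M x := by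
  unfold subFun
  obtain ⟨b0, b1⟩ := blendWeight_mem_Icc (s := s) x
  rcases b0.lt_or_eq with hb | hb
  · nlinarith [mul_nonneg (sub_nonneg.2 b1) h2.le]
  · rw [← hb]; simpa using h2

end Values

/-! ### §6 The horizontal derivative of the fill weight -/

/-- The derivative of `ψ` in a horizontal direction: `ψ₁'(ρ²)(1 - ψ₂(x₂)) dhsq`. [folklore] -/
theorem fderiv_pushCutoff_apply_of_coord_two_eq_zero (x : EuclideanSpace ℝ (Fin 3))
    {w : EuclideanSpace ℝ (Fin 3)} (hw : w 2 = 0) :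
    fderiv ℝ (pushCutoff s) x w =
      deriv (latCutoff s) (hsq x) * (1 - vertCutoff s (x 2)) * (2 * x 0 * w 0 + 2 * x 1 * w 1) := by
  have hL : HasFDerivAt (fun y : EuclideanSpace ℝ (Fin 3) => latCutoff s (hsq y))
      (deriv (latCutoff s) (hsq x) • dhsq x) x := by
    have hd : HasDerivAt (latCutoff s) (deriv (latCutoff s) (hsq x)) (hsq x) :=
      (contDiff_latCutoff.differentiable (by simp) _).hasDerivAt
    have := hd.hasFDerivAt.comp x (hasFDerivAt_hsq x)
    refine this.congr_fderiv ?_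
    ext u
    simp [ContinuousLinearMap.toSpanSingleton_apply, mul_comm]
  have hV : HasFDerivAt (fun y : EuclideanSpace ℝ (Fin 3) => vertCutoff s (y 2))
      (deriv (vertCutoff s) (x 2) • EuclideanSpace.proj (𝕜 := ℝ) (2 : Fin 3)) x := by
    have hd : HasDerivAt (vertCutoff s) (deriv (vertCutoff s) (x 2)) (x 2) :=
      (contDiff_vertCutoff.differentiable (by simp) _).hasDerivAt
    have := hd.hasFDerivAt.comp x (hasFDerivAt_coord 2 x)
    refine this.congr_fderiv ?_
    ext u
    simp [ContinuousLinearMap.toSpanSingleton_apply, mul_comm]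
  have h := (hL.fun_add hV).fun_sub (hL.fun_mul hV)
  have hp : pushCutoff s = fun y => latCutoff s (hsq y) + vertCutoff s (y 2) -
      latCutoff s (hsq y) * vertCutoff s (y 2) := rfl
  rw [hp, h.fderiv]
  simp only [sub_apply, add_apply, FunLike.coe_smul, Pi.smul_apply, smul_eq_mul, dhsq_apply,
    EuclideanSpace.coe_proj, hw, mul_zero, add_zero]
  ring

/-- `ψ₁' ≥ 0`. [folklore] -/
theorem deriv_latCutoff_nonneg (hs : 0 < s) (t : ℝ) : 0 ≤ deriv (latCutoff s) t :=
  (latCutoff_monotone hs).deriv_nonneg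

/-- **The horizontal derivative of the fill weight is a positive multiple of the horizontal
position**: for `w` horizontal,
`dw(x)(w) = (μ + 2M ψ₁'(ρ²)(1 - ψ₂(x₂))) (x₀w₀ + x₁w₁)` with `μ = 2s(1-θ) + 2θ ≥ 2s` and the
second coefficient `≥ 0`. [folklore] -/
theorem fderiv_fillWeight_apply_of_coord_two_eq_zero (hPd : Differentiable ℝ P) (hs : 0 < s)
    (x : EuclideanSpace ℝ (Fin 3)) {w : EuclideanSpace ℝ (Fin 3)} (hw : w 2 = 0) :
    fderiv ℝ (fillWeight P s δ M) x w =
      ((2 * s * (1 - deriv P ((rimFun s x - topFun s x) / (s / 8))) +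
          2 * deriv P ((rimFun s x - topFun s x) / (s / 8))) +
        2 * M * (deriv (latCutoff s) (hsq x) * (1 - vertCutoff s (x 2)))) *
      (x 0 * w 0 + x 1 * w 1) := by
  have hG : DifferentiableAt ℝ (lidFun P s) x := (hasFDerivAt_lidFun hPd hs x).differentiableAt
  have hC : HasFDerivAt (fun y : EuclideanSpace ℝ (Fin 3) => collarCutoff s (y 2))
      (deriv (collarCutoff s) (x 2) • EuclideanSpace.proj (𝕜 := ℝ) (2 : Fin 3)) x := by
    have hd : HasDerivAt (collarCutoff s) (deriv (collarCutoff s) (x 2)) (x 2) :=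
      (contDiff_collarCutoff.differentiable (by simp) _).hasDerivAt
    have := hd.hasFDerivAt.comp x (hasFDerivAt_coord 2 x)
    refine this.congr_fderiv ?_
    ext u
    simp [ContinuousLinearMap.toSpanSingleton_apply, mul_comm]
  have hψ : DifferentiableAt ℝ (pushCutoff s) x := (contDiff_pushCutoff.differentiable (by simp)) x
  have h : HasFDerivAt (fillWeight P s δ M)
      (fderiv ℝ (lidFun P s) x + (2 * δ) • (-(deriv (collarCutoff s) (x 2) •
        EuclideanSpace.proj (𝕜 := ℝ) (2 : Fin 3))) + M • fderiv ℝ (pushCutoff s) x) x := by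
    have h1 := hG.hasFDerivAt.const_add 1
    have h2 := (hC.const_sub 1).const_mul (2 * δ)
    have h3 := hψ.hasFDerivAt.const_mul M
    have := (h1.add h2).add h3
    refine this.congr_fderiv ?_
    rfl
  rw [h.fderiv]
  simp only [add_apply, FunLike.coe_smul, Pi.smul_apply, smul_eq_mul, neg_apply,
    EuclideanSpace.coe_proj, hw, mul_zero, neg_zero, add_zero,
    fderiv_lidFun_apply_of_coord_two_eq_zero hPd hs x hw,
    fderiv_pushCutoff_apply_of_coord_two_eq_zero x hw]
  ring

/-! ### §7 The plugs and the domain -/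

/-- `hsq` is continuous. [folklore] -/
theorem continuous_hsq : Continuous hsq := (contDiff_hsq (n := 0)).continuous

/-- Coordinates are continuous. [folklore] -/
theorem continuous_coord (i : Fin 3) : Continuous fun x : EuclideanSpace ℝ (Fin 3) => x i :=
  (contDiff_coord (n := 0) i).continuous

/-- Membership in the closed box, unfolded. [folklore] -/
theorem mem_closedBox_iff {x : EuclideanSpace ℝ (Fin 3)} :
    x ∈ closedBox s ↔ hsq x ≤ (1 + 3 * s) ^ 2 ∧ -6 * s ≤ x 2 ∧ x 2 ≤ 3 * s := Iff.rfl

/-- The closed box is closed. [folklore] -/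
theorem isClosed_closedBox : IsClosed (closedBox s) := by
  unfold closedBox
  exact (isClosed_le continuous_hsq continuous_const).inter
    ((isClosed_le continuous_const (continuous_coord 2)).inter
      (isClosed_le (continuous_coord 2) continuous_const))

/-- The open box is open. [folklore] -/
theorem isOpen_openBox {η : ℝ} : IsOpen (openBox s η) := by
  unfold openBox
  exact (isOpen_lt continuous_hsq continuous_const).inter
    ((isOpen_lt continuous_const (continuous_coord 2)).inter
      (isOpen_lt (continuous_coord 2) continuous_const))

/-- The first plug is closed (for closed `E₁`). [folklore] -/
theorem isClosed_plugOne {E₁ : Set (EuclideanSpace ℝ (Fin 3))} (hE₁ : IsClosed E₁) {η : ℝ} :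
    IsClosed (plugOne E₁ s η) :=
  hE₁.sdiff isOpen_openBox

/-- The second plug is closed. [folklore] -/
theorem isClosed_plugTwo {η : ℝ} : IsClosed (plugTwo s η) := by
  unfold plugTwo
  exact (isClosed_le continuous_hsq continuous_const).inter
    ((isClosed_le continuous_const (continuous_coord 2)).inter
      (isClosed_le (continuous_coord 2) continuous_const))

/-- **The domain of the sub-sphere function is open.** [folklore] -/
theorem isOpen_subDomain {E₁ : Set (EuclideanSpace ℝ (Fin 3))} (hE₁ : IsClosed E₁) {η : ℝ} :
    IsOpen (subDomain E₁ s η) :=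
  ((isClosed_plugOne hE₁).union isClosed_plugTwo).isOpen_compl

/-- Membership in the domain, unfolded. [folklore] -/
theorem mem_subDomain_iff {E₁ : Set (EuclideanSpace ℝ (Fin 3))} {η : ℝ}
    {x : EuclideanSpace ℝ (Fin 3)} :
    x ∈ subDomain E₁ s η ↔ x ∉ plugOne E₁ s η ∧ x ∉ plugTwo s η := by
  simp [subDomain]

end CappedBallLid

end Literature.Topology.FourManifolds

end
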